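import Literature.Analysis.FluidPDE.OnsagerBDSVStationaryPhaseBounds
import Literature.Analysis.FunctionSpaces.LandauKolmogorov
import HarnessLib

/-!
# BDSV stationary phase, IV: proof of (C.1) (`BDSV.phaseIntegralBound_holds`)

Buckmaster–De Lellis–Székelyhidi–Vicol, *Onsager's conjecture for admissible weak solutions*,
CPAM 72 (2019), App. C, Prop. C.2, estimate (C.1):
`|∫_{T³} a e^{ik·Φ}| ≲ (‖a‖_N + ‖a‖₀‖Φ‖_N)/|k|^N`, "a simple consequence of classical stationary
phase techniques" whose detailed proof is Daneri–Székelyhidi 2017, Lemma 2.2 (i). This file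
discharges the tree's transcription `BDSV.phaseIntegralBound` (`OnsagerBDSVStationaryPhase.lean`)
by assembling

* `N` integrations by parts along `∇φ/|∇φ|²` (`OnsagerBDSVStationaryPhaseIBP.lean`):
  `|∫ cos(2π m·Φ + θ) a| ≤ sup |Lᴺ a|`;
* the derivative bounds for `Lᴺ a` in geometric bookkeeping
  (`OnsagerBDSVStationaryPhaseBounds.lean`, `BDSV.abs_iterate_ibpOp_le`);
* the sup-norm interpolation inequality BDSV (A.3) in geometric form
  (`LandauKolmogorov.lean`, `exists_const_norm_iteratedFDeriv_le_of_geometric`), applied to the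
  lift of `a` (`‖Dˢã‖ ≤ K A₀ αˢ`, `αᴺ = 1 + A_N/A₀`) and to `∇D̃` (`‖Dˢ∇D̃‖ ≤ K P ρˢ`,
  `P = Ĉ + 1`, `ρᴺ = 1 + B_N/P`, `B_N = ‖Dᴺ⁺¹D̃‖_∞`), which turns
  `K A₀ (…)ᴺ (α + ρ)ᴺ |m|^{-N}` into `C(Ĉ, N) |m|^{-N} (A_N + A₀ + A₀ B_N)` and hence into the
  printed right-hand side `C |m|^{-N}(‖a‖_{C^N} + ‖a‖_{C⁰}‖D‖_{C^{N+1}})`.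

The constant depends on `Ĉ` and `N` only (through the interpolation constant `K_N`, the bound
`C_G(Ĉ, N)` for the derivatives of `v ↦ v/|v|²` on the annulus `Ĉ⁻¹ ≤ |v| ≤ Ĉ`, and `N!`,
powers of `2`, `3`, `Ĉ + 1`), as printed.

## References

* T. Buckmaster, C. De Lellis, L. Székelyhidi Jr., V. Vicol, *Onsager's conjecture for admissible
  weak solutions*, CPAM 72 (2019) = arXiv:1701.08678, App. C, Prop. C.2 (C.1); App. A (A.1)–(A.4).
  [`BuckmasterEtAl2018`]
* S. Daneri, L. Székelyhidi Jr., *Non-uniqueness and h-principle for Hölder-continuous weak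
  solutions of the Euler equations*, ARMA 224 (2017) = arXiv:1603.09714, Lemma 2.2 (i), proof.
  [`DaneriSzekelyhidi2017`]
-/

noncomputable section

open Set MeasureTheory
open scoped NNReal ENNReal ContDiff InnerProductSpace Nat

namespace Literature.Analysis.FluidPDE

namespace BDSV

open FunctionSpaces FunctionSpaces.Torus

/-! ## Sup-norm levels of lifts -/

section Levels

variable {Y : Type*} [NormedAddCommGroup Y] [NormedSpace ℝ Y]

/-- `‖Dʲ(g∘proj)‖_∞ ≤ ‖g‖_{C^{k,0}(T³)}` for `j ≤ k`. [folklore] -/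
theorem eSupNorm_iteratedFDeriv_lift_le {j k : ℕ} (hj : j ≤ k) (g : UnitAddTorus (Fin 3) → Y) :
    eSupNorm (iteratedFDeriv ℝ j (lift g)) ≤ Torus.eContDiffHolderNorm k 0 g :=
  iSup_le fun y => Torus.enorm_iteratedFDeriv_lift_le_eContDiffHolderNorm hj 0 g y

/-- All levels `‖Dʲ(g∘proj)‖_∞` of a smooth `g` on the torus are finite. [folklore] -/
theorem eSupNorm_iteratedFDeriv_lift_ne_top {g : UnitAddTorus (Fin 3) → Y} (hg : IsSmooth g) (j : ℕ) :
    eSupNorm (iteratedFDeriv ℝ j (lift g)) ≠ ⊤ :=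
  ((IsSmooth.memContDiffHolder_holds (r := 0) hg j zero_le_one).2.1 j le_rfl).ne

/-- The levels of `∇f` are the shifted levels of `f`. [folklore] -/
theorem eSupNorm_iteratedFDeriv_fderiv (f : EuclideanSpace ℝ (Fin 3) → Y) (j : ℕ) :
    eSupNorm (iteratedFDeriv ℝ j (fderiv ℝ f)) = eSupNorm (iteratedFDeriv ℝ (j + 1) f) := by
  unfold eSupNorm
  refine iSup_congr fun y => ?_
  rw [← ofReal_norm, ← ofReal_norm, norm_iteratedFDeriv_fderiv]

end Levels

/-! ## Two bookkeeping lemmas -/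

section Bookkeeping

/-- **The real arithmetic of the assembly.** With `αᴺ = (A_N + A₀)/A₀`, `ρᴺ = (B + P)/P`
(`P ≥ 1`), `0 < f ≤ c` (`f = |m|`, `c = 2π|m|`):
`K A₀ (3·2ᴺ c⁻¹ W)ᴺ (α + ρ)ᴺ ≤ [K (3·2ᴺ W)ᴺ 2ᴺ (P + 1)] f⁻ᴺ (A_N + A₀ + A₀ B)`, using
`(α + ρ)ᴺ ≤ 2ᴺ(αᴺ + ρᴺ)` and `A₀(αᴺ + ρᴺ) = A_N + A₀ + A₀(B + P)/P ≤ (P + 1)(A_N + A₀ + A₀B)`.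
[folklore] -/
theorem stationaryPhase_arith {K W c f A0 AN B P α ρ : ℝ} {N : ℕ} (hK : 0 ≤ K) (hW : 0 ≤ W)
    (hfc : f ≤ c) (hf : 0 < f) (hA0 : 0 < A0) (hAN : 0 ≤ AN) (hB : 0 ≤ B) (hP : 1 ≤ P)
    (hα : 0 ≤ α) (hρ : 0 ≤ ρ) (hαN : α ^ N = (AN + A0) / A0) (hρN : ρ ^ N = (B + P) / P) :
    K * A0 * (3 * 2 ^ N * (c⁻¹ * W)) ^ N * (α + ρ) ^ N ≤
      K * (3 * 2 ^ N * W) ^ N * 2 ^ N * (P + 1) * (f ^ N)⁻¹ * (AN + A0 + A0 * B) := by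
  have hP0 : 0 < P := lt_of_lt_of_le one_pos hP
  have hc0 : 0 < c := lt_of_lt_of_le hf hfc
  set S : ℝ := AN + A0 + A0 * B with hSdef
  have hS0 : 0 ≤ S := by positivity
  have hαρ : (α + ρ) ^ N ≤ 2 ^ N * (α ^ N + ρ ^ N) := add_pow_le_two_pow_mul_add_pow hα hρ N
  have hA0sum : A0 * (α ^ N + ρ ^ N) ≤ (P + 1) * S := by
    rw [hαN, hρN, mul_add, mul_div_cancel₀ _ hA0.ne']
    have h1 : (B + P) / P ≤ B + P := div_le_self (by positivity) hP
    have h2 : A0 * ((B + P) / P) ≤ A0 * (B + P) := mul_le_mul_of_nonneg_left h1 hA0.le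
    nlinarith [mul_nonneg hA0.le hB, mul_nonneg hP0.le hAN, mul_nonneg hP0.le (mul_nonneg hA0.le hB)]
  have hcinv : (c ^ N)⁻¹ ≤ (f ^ N)⁻¹ := inv_anti₀ (pow_pos hf N) (pow_le_pow_left₀ hf.le hfc N)
  have hM : K * A0 * (3 * 2 ^ N * (c⁻¹ * W)) ^ N * (α + ρ) ^ N =
      K * (3 * 2 ^ N * W) ^ N * (c ^ N)⁻¹ * (A0 * (α + ρ) ^ N) := by
    rw [mul_pow, mul_pow, mul_pow, inv_pow]; ring
  rw [hM]
  have hG0 : 0 ≤ K * (3 * 2 ^ N * W) ^ N := by positivity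
  calc K * (3 * 2 ^ N * W) ^ N * (c ^ N)⁻¹ * (A0 * (α + ρ) ^ N)
      ≤ K * (3 * 2 ^ N * W) ^ N * (c ^ N)⁻¹ * (A0 * (2 ^ N * (α ^ N + ρ ^ N))) := by
        gcongr
    _ = K * (3 * 2 ^ N * W) ^ N * (c ^ N)⁻¹ * 2 ^ N * (A0 * (α ^ N + ρ ^ N)) := by ring
    _ ≤ K * (3 * 2 ^ N * W) ^ N * (f ^ N)⁻¹ * 2 ^ N * ((P + 1) * S) := by
        gcongr
    _ = K * (3 * 2 ^ N * W) ^ N * 2 ^ N * (P + 1) * (f ^ N)⁻¹ * S := by ring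

/-- **Passage to `ℝ≥0∞`.** A real bound `I ≤ C f⁻ᴺ (A_N + A₀ + A₀B)` with
`A_N, A₀ ≤ X_N`, `A₀ ≤ X₀`, `B ≤ Y` (extended quantities) gives
`ofReal I ≤ ofReal(2C) · ofReal(f⁻ᴺ) · (X_N + X₀ Y)`. [folklore] -/
theorem stationaryPhase_ennreal {I C F AN A0 B : ℝ} {XN X0 YD : ℝ≥0∞} (hC : 0 ≤ C)
    (hF : 0 ≤ F) (hAN : 0 ≤ AN) (hA0 : 0 ≤ A0) (hB : 0 ≤ B)
    (hI : I ≤ C * F * (AN + A0 + A0 * B)) (hXN : ENNReal.ofReal AN ≤ XN)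
    (hXN' : ENNReal.ofReal A0 ≤ XN) (hX0 : ENNReal.ofReal A0 ≤ X0) (hYD : ENNReal.ofReal B ≤ YD) :
    ENNReal.ofReal I ≤ ENNReal.ofReal (2 * C) * ENNReal.ofReal F * (XN + X0 * YD) := by
  have hS : ENNReal.ofReal (AN + A0 + A0 * B) ≤ 2 * (XN + X0 * YD) := by
    rw [ENNReal.ofReal_add (by positivity) (by positivity), ENNReal.ofReal_add hAN hA0,
      ENNReal.ofReal_mul hA0, two_mul]
    calc ENNReal.ofReal AN + ENNReal.ofReal A0 + ENNReal.ofReal A0 * ENNReal.ofReal B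
        ≤ XN + XN + X0 * YD := by gcongr
      _ ≤ XN + X0 * YD + (XN + X0 * YD) := by
          have h : XN + XN + X0 * YD + X0 * YD = XN + X0 * YD + (XN + X0 * YD) := by ring
          exact le_self_add.trans (le_of_eq h)
  calc ENNReal.ofReal I ≤ ENNReal.ofReal (C * F * (AN + A0 + A0 * B)) := ENNReal.ofReal_le_ofReal hI
    _ = ENNReal.ofReal C * ENNReal.ofReal F * ENNReal.ofReal (AN + A0 + A0 * B) := by
        rw [ENNReal.ofReal_mul (by positivity), ENNReal.ofReal_mul hC]
    _ ≤ ENNReal.ofReal C * ENNReal.ofReal F * (2 * (XN + X0 * YD)) :=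
        mul_le_mul_right hS _
    _ = ENNReal.ofReal (2 * C) * ENNReal.ofReal F * (XN + X0 * YD) := by
        rw [ENNReal.ofReal_mul zero_le_two, ENNReal.ofReal_ofNat]; ring

end Bookkeeping

/-! ## The discharge -/

section Discharge

/-- **BDSV Prop. C.2, (C.1)** — discharge of `BDSV.phaseIntegralBound`: for `Ĉ ≥ 1`, `N ≥ 1`
there is `C = C(Ĉ, N)` such that for every smooth displacement `D` with
`Ĉ⁻¹|v| ≤ |(Id + ∇D)v| ≤ Ĉ|v|`, every `m ∈ ℤ³ ∖ {0}`, `θ ∈ ℝ` and smooth real `a`,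
`|∫_{T³} cos(2π m·(x + D(x)) + θ) a(x) dx| ≤ C |m|^{-N} (‖a‖_{C^N} + ‖a‖_{C⁰} ‖D‖_{C^{N+1}})`.
Proof: Daneri–Székelyhidi 2017, Lemma 2.2 (i) — `N` integrations by parts along `∇φ/|∇φ|²`
(`BDSV.norm_integral_phaseCos_mul_le`), the inductive derivative bounds for `Lᴺ a`
(`BDSV.abs_iterate_ibpOp_le`), and the interpolation inequality (A.3) in geometric form
(`exists_const_norm_iteratedFDeriv_le_of_geometric`) for the lift of `a` and for `∇D̃`.
[cite: BuckmasterEtAl2018, App. C Prop. C.2 (C.1)] -/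
theorem phaseIntegralBound_holds : phaseIntegralBound := by
  intro Ĉ hĈ N hN
  have hC0 : 0 < Ĉ := lt_of_lt_of_le one_pos hĈ
  have hN0 : N ≠ 0 := by omega
  -- the constants: interpolation constant `K = K(N)`, annulus bound `C_G = C_G(Ĉ, N)`
  obtain ⟨K, hK1, hK⟩ := exists_const_norm_iteratedFDeriv_le_of_geometric.{0, 0} N
  obtain ⟨CG, hCG0, hCG⟩ := exists_bound_iteratedFDerivWithin_recipVec hĈ N
  have hK0 : (0 : ℝ) ≤ K := by linarith
  set P : ℝ := Ĉ + 1 with hPdef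
  have hP1 : 1 ≤ P := by rw [hPdef]; linarith
  have hP0 : 0 < P := by linarith
  set W : ℝ := N ! * CG * (K * P) ^ N with hWdef
  have hW0 : 0 ≤ W := by positivity
  set Cfin : ℝ := K * (3 * 2 ^ N * W) ^ N * 2 ^ N * (P + 1) with hCfin
  have hCfin0 : 0 ≤ Cfin := by positivity
  refine ⟨(2 * Cfin).toNNReal, ?_⟩
  intro D hD hND m hm θ a ha
  -- the right-hand side in `ℝ≥0∞`
  change _ ≤ ENNReal.ofReal (2 * Cfin) * freqPow m (-(N : ℝ)) *
    (Torus.eContDiffHolderNorm N 0 a +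
      Torus.eContDiffHolderNorm 0 0 a * Torus.eContDiffHolderNorm (N + 1) 0 D)
  -- levels
  have hfa : ∀ j, eSupNorm (iteratedFDeriv ℝ j (lift a)) ≠ ⊤ := eSupNorm_iteratedFDeriv_lift_ne_top ha
  have hfD : ∀ j, eSupNorm (iteratedFDeriv ℝ j (lift D)) ≠ ⊤ := eSupNorm_iteratedFDeriv_lift_ne_top hD
  set A0 : ℝ := (eSupNorm (iteratedFDeriv ℝ 0 (lift a))).toReal with hA0def
  set AN : ℝ := (eSupNorm (iteratedFDeriv ℝ N (lift a))).toReal with hANdef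
  set B : ℝ := (eSupNorm (iteratedFDeriv ℝ (N + 1) (lift D))).toReal with hBdef
  have hA00 : 0 ≤ A0 := ENNReal.toReal_nonneg
  have hAN0 : 0 ≤ AN := ENNReal.toReal_nonneg
  have hB0 : 0 ≤ B := ENNReal.toReal_nonneg
  -- the case `a = 0`
  rcases hA00.eq_or_lt with hA0z | hA0pos
  · have ha0 : ∀ x, a x = 0 := by
      intro x
      obtain ⟨y, rfl⟩ := proj_surjective x
      have h := norm_le_toReal_eSupNorm (hfa 0) y
      rw [norm_iteratedFDeriv_zero, ← hA0def, ← hA0z] at h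
      exact norm_le_zero_iff.1 h
    have hint : (fun x => phaseCos m D θ x * a x) = fun _ => 0 := funext fun x => by
      rw [ha0 x, mul_zero]
    rw [hint, integral_zero, enorm_zero]
    exact zero_le
  -- interpolation for the lift of `a`: `‖Dˢã‖ ≤ K A₀ αˢ`, `αᴺ = (A_N + A₀)/A₀`
  set α : ℝ := ((AN + A0) / A0) ^ ((N : ℝ)⁻¹) with hαdef
  have hbase : 0 < (AN + A0) / A0 := by positivity
  have hα0 : 0 < α := Real.rpow_pos_of_pos hbase _
  have hαN : α ^ N = (AN + A0) / A0 := by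
    rw [hαdef]; exact Real.rpow_inv_natCast_pow hbase.le hN0
  have haN : ContDiff ℝ N (lift a) := ha.of_le (by exact_mod_cast le_top)
  have haA : ∀ s ≤ N, ∀ y, ‖iteratedFDeriv ℝ s (lift a) y‖ ≤ K * A0 * α ^ s := by
    intro s hs y
    refine hK haN (fun j _ => hfa j) hα0 le_rfl ?_ hs y
    rw [hαN, ← hANdef, mul_div_cancel₀ _ hA0pos.ne']
    linarith
  -- interpolation for `∇D̃`: `‖Dˢ∇D̃‖ ≤ K P ρˢ`, `ρᴺ = (B + P)/P`
  set T : EuclideanSpace ℝ (Fin 3) → (EuclideanSpace ℝ (Fin 3) →L[ℝ] EuclideanSpace ℝ (Fin 3)) :=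
    fderiv ℝ (lift D) with hTdef
  have hTN : ContDiff ℝ N T := hD.fderiv_right (by exact_mod_cast le_top)
  have hTlev : ∀ j, eSupNorm (iteratedFDeriv ℝ j T) = eSupNorm (iteratedFDeriv ℝ (j + 1) (lift D)) :=
    fun j => eSupNorm_iteratedFDeriv_fderiv (lift D) j
  have hTfin : ∀ j ≤ N, eSupNorm (iteratedFDeriv ℝ j T) ≠ ⊤ := fun j _ => by
    rw [hTlev]; exact hfD (j + 1)
  have hT0 : (eSupNorm (iteratedFDeriv ℝ 0 T)).toReal ≤ P := by
    refine ENNReal.toReal_le_of_le_ofReal hP0.le (iSup_le fun y => ?_)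
    rw [← ofReal_norm, norm_iteratedFDeriv_zero]
    refine ENNReal.ofReal_le_ofReal ?_
    rw [hTdef, fderiv_lift]
    exact norm_fderiv_le_of_isNondegenerate hND (proj y)
  set ρ : ℝ := ((B + P) / P) ^ ((N : ℝ)⁻¹) with hρdef
  have hbase' : 1 ≤ (B + P) / P := by rw [le_div_iff₀ hP0]; linarith
  have hρ1 : 1 ≤ ρ := Real.one_le_rpow hbase' (by positivity)
  have hρ0 : 0 < ρ := lt_of_lt_of_le one_pos hρ1
  have hρN : ρ ^ N = (B + P) / P := by
    rw [hρdef]; exact Real.rpow_inv_natCast_pow (zero_le_one.trans hbase') hN0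
  have hT : ∀ s ≤ N, ∀ y, ‖iteratedFDeriv ℝ s T y‖ ≤ K * P * ρ ^ s := by
    intro s hs y
    refine hK hTN hTfin hρ0 hT0 ?_ hs y
    rw [hρN, hTlev N, ← hBdef, mul_div_cancel₀ _ hP0.ne']
    linarith
  -- the sup bound for `Lᴺ a` and the integrations by parts
  have hKP : 1 ≤ K * P := one_le_mul_of_one_le_of_one_le hK1 hP1
  have hsup := abs_iterate_ibpOp_le hĈ hD hND hm ha hCG0 hCG (mul_nonneg hK0 hA00) hα0.le hKP hρ1
    haA hT
  have hI := norm_integral_phaseCos_mul_le hĈ hD hND hm θ ha N hsup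
  -- arithmetic and passage to `ℝ≥0∞`
  have hfv : 0 < ‖latticeVec m‖ := norm_latticeVec_pos hm
  have hfc : ‖latticeVec m‖ ≤ 2 * Real.pi * ‖latticeVec m‖ := by nlinarith [Real.two_le_pi]
  have hreal := hI.trans (stationaryPhase_arith hK0 hW0 hfc hfv hA0pos hAN0 hB0 hP1 hα0.le hρ0.le
    hαN hρN)
  have hfreq : freqPow m (-(N : ℝ)) = ENNReal.ofReal ((‖latticeVec m‖ ^ N)⁻¹) := by
    rw [freqPow, ← norm_latticeVec_eq_sqrt, Real.rpow_neg hfv.le, Real.rpow_natCast]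
  have hAN' : ENNReal.ofReal AN ≤ Torus.eContDiffHolderNorm N 0 a := by
    rw [hANdef, ENNReal.ofReal_toReal (hfa N)]; exact eSupNorm_iteratedFDeriv_lift_le le_rfl a
  have hA0' : ENNReal.ofReal A0 ≤ Torus.eContDiffHolderNorm N 0 a := by
    rw [hA0def, ENNReal.ofReal_toReal (hfa 0)]; exact eSupNorm_iteratedFDeriv_lift_le (Nat.zero_le N) a
  have hA0'' : ENNReal.ofReal A0 ≤ Torus.eContDiffHolderNorm 0 0 a := by
    rw [hA0def, ENNReal.ofReal_toReal (hfa 0)]; exact eSupNorm_iteratedFDeriv_lift_le le_rfl a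
  have hB' : ENNReal.ofReal B ≤ Torus.eContDiffHolderNorm (N + 1) 0 D := by
    rw [hBdef, ENNReal.ofReal_toReal (hfD (N + 1))]; exact eSupNorm_iteratedFDeriv_lift_le le_rfl D
  rw [← ofReal_norm, hfreq]
  exact stationaryPhase_ennreal hCfin0 (inv_nonneg.2 (pow_nonneg hfv.le N)) hAN0 hA00 hB0 hreal
    hAN' hA0' hA0'' hB'

end Discharge

end BDSV

end Literature.Analysis.FluidPDE
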